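import Mathlib
import Literature.MathematicalPhysics.QuantumFieldTheory.Balaban1983to89.QGQInverse
import Literature.MathematicalPhysics.QuantumFieldTheory.Balaban1983to89.B9SectEKernel

/-! # `Balaban1983to89.B9SectDForm` — the finite-dimensional skeleton of the first-order FORM bound of
B9 Sect. D (Theorem 3.12): block Schur test, transfer through the inverse, numerical radius ⇒ energy-norm
contraction, energy-norm bound `rⁿ` on the `n`-th Neumann term of (3.130)/(3.138), and the form sandwich /
positivity of `G`, `G₁` — kernel-checked

CITATION HEADER. Supports the reading (unit `b2b-balaban-r1-g5`, reader group A gen 5, cell pub-balaban) of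
T. Balaban, *Propagators for lattice gauge theories in a background field*, Commun. Math. Phys. 99 (1985) 389–434
[`Balaban1985BackgroundPropagators`] (= B9), Sect. D pp. 419–423 [PDF 31–35] (renders
`1985-cmp99-background-propagators-p031-x2.png` … `-p035-x2.png`):
*"⟨A, Δ_πA⟩ = ⟨A, ΔA⟩ − ⟨i[(G′RD*A)(b₋), A(b)] − i[A(b), R_b(G′RD*A)(b₊)] − i[(G′RD*A)(b₋), (DG′RD*A)(b)], J⟩
= ⟨A, ΔA⟩ − ⟨A, Δ′_πA⟩ (3.120)"*, *"G₀ = (Δ + DRD* + Q*aQ)⁻¹. From (3.120) we get G = G₀(I − Δ′_πG₀)⁻¹ =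
Σ_{n=0}^∞ G₀(Δ′_πG₀)ⁿ (3.130)"*, *"G₁ = G₀(I − (Δ′_π + Δ_π^{(2)})G₀)⁻¹ = Σ_{n=0}^∞ G₀((Δ′_π + Δ_π^{(2)})G₀)ⁿ
(3.138)"*, and Theorem 3.12 (p. 423): *"If an external gauge field configuration U satisfies both regularity
conditions (3.35), (3.36) for α₀ sufficiently small, then Theorems 3.3, 3.10, 3.11 hold for the propagators G, G₁,
with one exception … The exception is the inequality in (3.42) involving the covariant Laplace operator. It does
not hold for G, G₁."*; Theorem 3.11 (p. 416): *"Under the assumptions of the Theorems 3.1–3.10 (i.e. for M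
sufficiently large and α₀ sufficiently small) the operators Δ′_a, G′, (Q′G′²Q′*)⁻¹, Δ_a, G are positive definite."*;
Theorem 3.3 (p. 399) with (3.46) (p. 398): *"‖hG′(U)λ‖, ‖h∇_UG′(U)λ‖, … ≤ B₀[(L^jη)², L^jη, L^jη, 1, 1, 1]|h|
e^{−δ₀d(y,y′)}‖λ‖ for supp h ⊂ Δ(y), y ∈ Λ_j, supp λ ⊂ Δ(y′)"*. GAPS G-B9-16 (b09): *"the norm in which (3.130)
converges, the form (O(1)α₀)^n of its n-th term, and the transfer of … Thm 3.11 (positivity) to G, G₁ … are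
asserted"*. The written repair is `HOME/b2b-balaban-r1/SectD-form-bound-proof.md` (this unit): the relative bound
(N′) `|⟨A, (Δ′_π + Δ_π^{(2)})A⟩| ≤ r⟨A, G₀⁻¹A⟩`, `r = c_N·Mα₀`, from printed statements (Thm 3.1/3.3 (3.46)
entries 1–2, (3.49), Thm 3.11, B6 Lemma 2.1, (3.120), (3.128), (3.134), (3.137), (3.35)–(3.36)).

WHAT THIS FILE CERTIFIES (kernel; finite index sets, real scalars; `S` plays `S₀ = G₀⁻¹ = Δ + DRD* + Q*aQ`,
symmetric positive definite by Theorem 3.11; `T` plays `T′ = Δ′_π (+ Δ_π^{(2)})`, symmetric; `S⁻¹` plays `G₀`):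
1. `schur_core`, `block_schur_sq` — the BLOCK Schur test: block bounds `|⟨u_y, K v_{y′}⟩| ≤ N(y,y′)‖u_y‖‖v_{y′}‖`
   with row sums `≤ R` and column sums `≤ C` give `⟨u, Kv⟩² ≤ RC‖u‖²‖v‖²` (Lemma A of the md: how the block
   inequalities (3.46)/(3.49) with the B6 Lemma 2.1 sums become global `L²` bounds; no Hölder norms, no sup→L²).
2. `sq_norm_le_of_inverse_test` — transfer through the inverse (Lemma B): `‖T G₀ Tᵀ‖ ≤ C` ⇒ `‖TA‖² ≤ C⟨A, S₀A⟩`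
   (used with `T = w^{1/2}` — weighted mass — and, via the md's Prop. 4.4, for the divergence `D*`).
3. `energy_cs`, `form_expand`, `dual_energy_le`, `energy_pow_le`, `neumann_term_sq_le` — Lemma C: the
   numerical-radius hypothesis (N′) `|⟨A, TA⟩| ≤ r⟨A, SA⟩` gives `⟨TA, S⁻¹TA⟩ ≤ r²⟨A, SA⟩`, the energy-norm
   contraction of `Z = S⁻¹T`, and the bound `⟨u, S⁻¹(TS⁻¹)ⁿv⟩² ≤ r^{2n}⟨u, S⁻¹u⟩⟨v, S⁻¹v⟩` on the `n`-th term of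
   (3.130)/(3.138): "the norm in which (3.130) converges, the form (O(1)α₀)ⁿ of its n-th term".
4. `inv_form_le_of_form_le`, `sub_form_bounds`, `G1_sandwich` — Lemma D: `S₁ ≤ κS₂ ⇒ κ⁻¹S₂⁻¹ ≤ S₁⁻¹`, hence
   under (N′) with `r < 1`: `S − T` is coercive (positivity of `G⁻¹`, `G₁⁻¹`: the Theorem 3.11 clause of
   Theorem 3.12) and `(1+r)⁻¹G₀ ≤ (S − T)⁻¹ ≤ (1−r)⁻¹G₀` as forms.
5. `rel_bound_of_abs_bound` — the AM–GM assembly of §5 of the md (absolute bound in `‖A‖_w‖D*A‖`, `‖D*A‖²`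
   plus the two energy controls ⇒ relative bound).
WHAT IT DOES NOT CERTIFY: the lattice bookkeeping of the md §§4–6 (which bond meets which block, the counting
factors), the curvature bounds (F)/(J) from (3.35)–(3.36), the duality step for (3.137), and of course the printed
theorems themselves. No statement of the series is asserted; value = kernel certificate of a located-gap repair.
All lemmas are [folklore] finite-dimensional linear algebra.
-/

namespace Literature.MathematicalPhysics.QuantumFieldTheory.Balaban1983to89.B9SectDForm

open Matrix Finset QGQInverse B9SectEKernel

variable {n m : Type*} [Fintype n] [Fintype m]

/-! ## 0. Rewriting helper -/

-- `dot_mulVec_symm` (symmetric forms) and `dot_transpose_mulVec` (transpose = adjoint) are reused from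
-- `B9SectEKernel`.

/-- `S S⁻¹ x = x` for a unit. [folklore] -/
theorem mulVec_inv_cancel [DecidableEq n] {S : Matrix n n ℝ} (hunit : IsUnit S) (x : n → ℝ) :
    S *ᵥ (S⁻¹ *ᵥ x) = x := by
  have hU : IsUnit S.det := (Matrix.isUnit_iff_isUnit_det S).mp hunit
  rw [Matrix.mulVec_mulVec, Matrix.mul_nonsing_inv S hU, Matrix.one_mulVec]

section schur

/-! ## 1. The block Schur test (Lemma A) -/

variable {ι κ Y : Type*} [Fintype ι] [Fintype κ] [Fintype Y]

/-- Core of the block Schur test: if `|Φ(y,y′)| ≤ N(y,y′) a_y b_{y′}` with `N ≥ 0`, row sums `≤ R`, column sums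
`≤ C`, then `(Σ Φ)² ≤ R C (Σ a²)(Σ b²)`. [folklore] -/
theorem schur_core (N Φ : Y → Y → ℝ) (a b : Y → ℝ) (ha : ∀ y, 0 ≤ a y) (hb : ∀ y, 0 ≤ b y)
    (hN : ∀ y y', 0 ≤ N y y') {R C : ℝ} (hR0 : 0 ≤ R) (hR : ∀ y, ∑ y', N y y' ≤ R)
    (hC : ∀ y', ∑ y, N y y' ≤ C) (hΦ : ∀ y y', |Φ y y'| ≤ N y y' * a y * b y') :
    (∑ y, ∑ y', Φ y y') ^ 2 ≤ R * C * (∑ y, a y ^ 2) * (∑ y', b y' ^ 2) := by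
  -- |Σ Φ| ≤ Σ N a b
  have h1 : |∑ y, ∑ y', Φ y y'| ≤ ∑ y, ∑ y', N y y' * a y * b y' := by
    refine (Finset.abs_sum_le_sum_abs _ _).trans (Finset.sum_le_sum fun y _ => ?_)
    exact (Finset.abs_sum_le_sum_abs _ _).trans (Finset.sum_le_sum fun y' _ => hΦ y y')
  -- Cauchy–Schwarz over pairs
  have h2 : (∑ p : Y × Y, N p.1 p.2 * a p.1 * b p.2) ^ 2 ≤
      (∑ p : Y × Y, N p.1 p.2 * a p.1 ^ 2) * ∑ p : Y × Y, N p.1 p.2 * b p.2 ^ 2 := by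
    refine Finset.sum_sq_le_sum_mul_sum_of_sq_le_mul _ (fun p _ => ?_) (fun p _ => ?_) (fun p _ => ?_)
    · exact mul_nonneg (hN _ _) (sq_nonneg _)
    · exact mul_nonneg (hN _ _) (sq_nonneg _)
    · exact le_of_eq (by ring)
  have e1 : (∑ p : Y × Y, N p.1 p.2 * a p.1 * b p.2) = ∑ y, ∑ y', N y y' * a y * b y' :=
    Fintype.sum_prod_type _
  have e2 : (∑ p : Y × Y, N p.1 p.2 * a p.1 ^ 2) = ∑ y, ∑ y', N y y' * a y ^ 2 :=
    Fintype.sum_prod_type _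
  have e3 : (∑ p : Y × Y, N p.1 p.2 * b p.2 ^ 2) = ∑ y, ∑ y', N y y' * b y' ^ 2 :=
    Fintype.sum_prod_type _
  rw [e1, e2, e3] at h2
  -- row sums
  have h3 : ∑ y, ∑ y', N y y' * a y ^ 2 ≤ R * ∑ y, a y ^ 2 := by
    rw [Finset.mul_sum]
    refine Finset.sum_le_sum fun y _ => ?_
    have e : ∑ y', N y y' * a y ^ 2 = (∑ y', N y y') * a y ^ 2 := by rw [Finset.sum_mul]
    rw [e]
    exact mul_le_mul_of_nonneg_right (hR y) (sq_nonneg _)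
  -- column sums
  have h4 : ∑ y, ∑ y', N y y' * b y' ^ 2 ≤ C * ∑ y', b y' ^ 2 := by
    rw [Finset.sum_comm, Finset.mul_sum]
    refine Finset.sum_le_sum fun y' _ => ?_
    have e : ∑ y, N y y' * b y' ^ 2 = (∑ y, N y y') * b y' ^ 2 := by rw [Finset.sum_mul]
    rw [e]
    exact mul_le_mul_of_nonneg_right (hC y') (sq_nonneg _)
  have h5 : 0 ≤ ∑ y, ∑ y', N y y' * b y' ^ 2 :=
    Finset.sum_nonneg fun y _ => Finset.sum_nonneg fun y' _ => mul_nonneg (hN _ _) (sq_nonneg _)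
  have h6 : 0 ≤ ∑ y, ∑ y', N y y' * a y * b y' :=
    Finset.sum_nonneg fun y _ => Finset.sum_nonneg fun y' _ =>
      mul_nonneg (mul_nonneg (hN _ _) (ha _)) (hb _)
  have h7 : (∑ y, ∑ y', Φ y y') ^ 2 ≤ (∑ y, ∑ y', N y y' * a y * b y') ^ 2 := by
    rw [← sq_abs (∑ y, ∑ y', Φ y y')]
    exact pow_le_pow_left₀ (abs_nonneg _) h1 2
  have h8 : (∑ y, ∑ y', N y y' * a y ^ 2) * (∑ y, ∑ y', N y y' * b y' ^ 2) ≤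
      (R * ∑ y, a y ^ 2) * (C * ∑ y', b y' ^ 2) :=
    mul_le_mul h3 h4 h5 (mul_nonneg hR0 (Finset.sum_nonneg fun y _ => sq_nonneg _))
  calc (∑ y, ∑ y', Φ y y') ^ 2 ≤ (∑ y, ∑ y', N y y' * a y * b y') ^ 2 := h7
    _ ≤ (∑ y, ∑ y', N y y' * a y ^ 2) * (∑ y, ∑ y', N y y' * b y' ^ 2) := h2
    _ ≤ (R * ∑ y, a y ^ 2) * (C * ∑ y', b y' ^ 2) := h8
    _ = R * C * (∑ y, a y ^ 2) * (∑ y', b y' ^ 2) := by ring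

omit [Fintype ι] in
/-- `u = Σ_y 𝟙_{β⁻¹{y}} u`: a vector is the sum of its restrictions to the blocks (fibres) of a block map
`β`. [folklore] -/
theorem sum_indicator_fiber (β : ι → Y) (u : ι → ℝ) : ∑ y, Set.indicator (β ⁻¹' {y}) u = u := by
  classical
  funext i
  rw [Finset.sum_apply]
  simp [Set.indicator_apply]

/-- `Σ_y ‖𝟙_{β⁻¹{y}} u‖² = ‖u‖²`. [folklore] -/
theorem sum_indicator_fiber_sq (β : ι → Y) (u : ι → ℝ) :
    ∑ y, Set.indicator (β ⁻¹' {y}) u ⬝ᵥ Set.indicator (β ⁻¹' {y}) u = u ⬝ᵥ u := by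
  classical
  have e : ∀ y i, Set.indicator (β ⁻¹' {y}) u i * Set.indicator (β ⁻¹' {y}) u i =
      if β i = y then u i * u i else 0 := by
    intro y i
    simp only [Set.indicator_apply, Set.mem_preimage, Set.mem_singleton_iff]
    split_ifs <;> simp
  simp only [dotProduct, e]
  rw [Finset.sum_comm]
  refine Finset.sum_congr rfl fun i _ => ?_
  simp

/-- **Block Schur test (Lemma A of the md).** For a real matrix `K : ι × κ`, block maps `β`, `γ` into a finite
block set `Y` (blocks = fibres `β⁻¹{y}`, `γ⁻¹{y′}`; restriction = `Set.indicator`), and block bounds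
`|⟨u_y, K v_{y′}⟩| ≤ N(y,y′)‖u_y‖‖v_{y′}‖` with `N ≥ 0`, row sums `≤ R` (`R ≥ 0`) and column sums `≤ C`:
`⟨u, Kv⟩² ≤ R·C·‖u‖²‖v‖²`. This is how the block inequalities (3.46), (3.49) together with the B6 Lemma 2.1 sums
(2.61) become global `L²` operator bounds. [folklore] -/
theorem block_schur_sq (K : Matrix ι κ ℝ) (β : ι → Y) (γ : κ → Y) (N : Y → Y → ℝ)
    (hN : ∀ y y', 0 ≤ N y y') {R C : ℝ} (hR0 : 0 ≤ R) (hR : ∀ y, ∑ y', N y y' ≤ R)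
    (hC : ∀ y', ∑ y, N y y' ≤ C)
    (hK : ∀ y y' (u : ι → ℝ) (v : κ → ℝ),
      |Set.indicator (β ⁻¹' {y}) u ⬝ᵥ (K *ᵥ Set.indicator (γ ⁻¹' {y'}) v)| ≤
        N y y' * Real.sqrt (Set.indicator (β ⁻¹' {y}) u ⬝ᵥ Set.indicator (β ⁻¹' {y}) u) *
          Real.sqrt (Set.indicator (γ ⁻¹' {y'}) v ⬝ᵥ Set.indicator (γ ⁻¹' {y'}) v))
    (u : ι → ℝ) (v : κ → ℝ) :
    (u ⬝ᵥ (K *ᵥ v)) ^ 2 ≤ R * C * (u ⬝ᵥ u) * (v ⬝ᵥ v) := by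
  -- decomposition of the bilinear form over blocks
  have hdec : u ⬝ᵥ (K *ᵥ v) =
      ∑ y, ∑ y', Set.indicator (β ⁻¹' {y}) u ⬝ᵥ (K *ᵥ Set.indicator (γ ⁻¹' {y'}) v) := by
    conv_lhs => rw [← sum_indicator_fiber β u, ← sum_indicator_fiber γ v]
    rw [Matrix.mulVec_sum, sum_dotProduct]
    refine Finset.sum_congr rfl fun y _ => ?_
    rw [dotProduct_sum]
  have ha2 : ∀ y, Real.sqrt (Set.indicator (β ⁻¹' {y}) u ⬝ᵥ Set.indicator (β ⁻¹' {y}) u) ^ 2 =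
      Set.indicator (β ⁻¹' {y}) u ⬝ᵥ Set.indicator (β ⁻¹' {y}) u := fun y =>
    Real.sq_sqrt (Literature.LinearAlgebra.Matrix.dotProduct_self_nonneg_real _)
  have hb2 : ∀ y', Real.sqrt (Set.indicator (γ ⁻¹' {y'}) v ⬝ᵥ Set.indicator (γ ⁻¹' {y'}) v) ^ 2 =
      Set.indicator (γ ⁻¹' {y'}) v ⬝ᵥ Set.indicator (γ ⁻¹' {y'}) v := fun y' =>
    Real.sq_sqrt (Literature.LinearAlgebra.Matrix.dotProduct_self_nonneg_real _)
  have h := schur_core N (fun y y' => Set.indicator (β ⁻¹' {y}) u ⬝ᵥ (K *ᵥ Set.indicator (γ ⁻¹' {y'}) v))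
    (fun y => Real.sqrt (Set.indicator (β ⁻¹' {y}) u ⬝ᵥ Set.indicator (β ⁻¹' {y}) u))
    (fun y' => Real.sqrt (Set.indicator (γ ⁻¹' {y'}) v ⬝ᵥ Set.indicator (γ ⁻¹' {y'}) v))
    (fun y => Real.sqrt_nonneg _) (fun y' => Real.sqrt_nonneg _) hN hR0 hR hC (fun y y' => hK y y' u v)
  simp only [ha2, hb2, sum_indicator_fiber_sq] at h
  rw [hdec]
  exact h

end schur

section transfer

/-! ## 2. Transfer through the inverse (Lemma B) -/

variable [DecidableEq n]

/-- **Lemma B.** `S` symmetric, invertible, with nonnegative form (plays `S₀ = G₀⁻¹`); if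
`⟨Tᵀu, S⁻¹Tᵀu⟩ ≤ C‖u‖²` for all `u` (i.e. `‖T G₀ Tᵀ‖ ≤ C`), then `‖TA‖² ≤ C⟨A, SA⟩` for all `A`.
(Variational proof: test `μ = C⁻¹TᵀTA` in `2⟨A,μ⟩ − ⟨A,SA⟩ ≤ ⟨μ, S⁻¹μ⟩`.) With `T` = diagonal weight this is the
weighted-mass bound ‖A‖²_w ≤ c₀⟨A, G₀⁻¹A⟩ from (3.46) entry 1; the md's Prop. 4.4 uses it for `T = D*`.
[folklore] -/
theorem sq_norm_le_of_inverse_test (S : Matrix n n ℝ) (hS : S.IsSymm) (hunit : IsUnit S)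
    (hpos : ∀ v : n → ℝ, 0 ≤ v ⬝ᵥ (S *ᵥ v)) (T : Matrix m n ℝ) {C : ℝ} (hC : 0 < C)
    (hT : ∀ u : m → ℝ, (Tᵀ *ᵥ u) ⬝ᵥ (S⁻¹ *ᵥ (Tᵀ *ᵥ u)) ≤ C * (u ⬝ᵥ u)) (A : n → ℝ) :
    (T *ᵥ A) ⬝ᵥ (T *ᵥ A) ≤ C * (A ⬝ᵥ (S *ᵥ A)) := by
  set u := T *ᵥ A with hu
  have h := two_dot_sub_form_le_inv_form S hS hunit hpos A (C⁻¹ • (Tᵀ *ᵥ u))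
  simp only [dotProduct_smul, Matrix.mulVec_smul, smul_dotProduct, smul_eq_mul] at h
  have e1 : A ⬝ᵥ (Tᵀ *ᵥ u) = u ⬝ᵥ u := by
    rw [dot_transpose_mulVec]
  rw [e1] at h
  have h2 := hT u
  have hc' : 0 ≤ C⁻¹ := inv_nonneg.mpr hC.le
  have h3 : C⁻¹ * (C⁻¹ * ((Tᵀ *ᵥ u) ⬝ᵥ (S⁻¹ *ᵥ (Tᵀ *ᵥ u)))) ≤ C⁻¹ * (C⁻¹ * (C * (u ⬝ᵥ u))) :=
    mul_le_mul_of_nonneg_left (mul_le_mul_of_nonneg_left h2 hc') hc'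
  have e2 : C⁻¹ * (C⁻¹ * (C * (u ⬝ᵥ u))) = C⁻¹ * (u ⬝ᵥ u) := by
    field_simp
  rw [e2] at h3
  have h4 : C⁻¹ * (u ⬝ᵥ u) ≤ A ⬝ᵥ (S *ᵥ A) := by linarith
  calc u ⬝ᵥ u = C * (C⁻¹ * (u ⬝ᵥ u)) := by field_simp
    _ ≤ C * (A ⬝ᵥ (S *ᵥ A)) := mul_le_mul_of_nonneg_left h4 hC.le

end transfer

section energy

/-! ## 3. Numerical radius ⇒ energy-norm contraction ⇒ `n`-th Neumann term (Lemma C) -/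

variable [DecidableEq n]

omit [DecidableEq n] in
/-- Cauchy–Schwarz for the (semi-)inner product `⟨A, SB⟩` of a symmetric matrix with nonnegative form.
[folklore] -/
theorem energy_cs (S : Matrix n n ℝ) (hS : S.IsSymm) (hpos : ∀ v : n → ℝ, 0 ≤ v ⬝ᵥ (S *ᵥ v))
    (A B : n → ℝ) :
    (A ⬝ᵥ (S *ᵥ B)) ^ 2 ≤ (A ⬝ᵥ (S *ᵥ A)) * (B ⬝ᵥ (S *ᵥ B)) := by
  have e1 : B ⬝ᵥ (S *ᵥ A) = A ⬝ᵥ (S *ᵥ B) := by rw [dot_mulVec_symm hS, dotProduct_comm]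
  have h : ∀ t : ℝ,
      0 ≤ (B ⬝ᵥ (S *ᵥ B)) * (t * t) + (-(2 * (A ⬝ᵥ (S *ᵥ B)))) * t + A ⬝ᵥ (S *ᵥ A) := by
    intro t
    have h0 := hpos (A - t • B)
    have e : (A - t • B) ⬝ᵥ (S *ᵥ (A - t • B)) =
        (B ⬝ᵥ (S *ᵥ B)) * (t * t) + (-(2 * (A ⬝ᵥ (S *ᵥ B)))) * t + A ⬝ᵥ (S *ᵥ A) := by
      simp only [Matrix.mulVec_sub, Matrix.mulVec_smul, sub_dotProduct, dotProduct_sub, smul_dotProduct,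
        dotProduct_smul, smul_eq_mul, e1]
      ring
    rw [← e]
    exact h0
  have hd := discrim_le_zero h
  unfold discrim at hd
  nlinarith [hd]

omit [DecidableEq n] in
/-- Expansion of a symmetric quadratic form on `s•A + B` and `s•A − B`. [folklore] -/
theorem form_expand (T : Matrix n n ℝ) (hT : T.IsSymm) (s : ℝ) (A B : n → ℝ) :
    (s • A + B) ⬝ᵥ (T *ᵥ (s • A + B)) =
        s ^ 2 * (A ⬝ᵥ (T *ᵥ A)) + 2 * s * (A ⬝ᵥ (T *ᵥ B)) + B ⬝ᵥ (T *ᵥ B) ∧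
    (s • A - B) ⬝ᵥ (T *ᵥ (s • A - B)) =
        s ^ 2 * (A ⬝ᵥ (T *ᵥ A)) - 2 * s * (A ⬝ᵥ (T *ᵥ B)) + B ⬝ᵥ (T *ᵥ B) := by
  have e1 : B ⬝ᵥ (T *ᵥ A) = A ⬝ᵥ (T *ᵥ B) := by rw [dot_mulVec_symm hT, dotProduct_comm]
  constructor
  · simp only [Matrix.mulVec_add, Matrix.mulVec_smul, add_dotProduct, dotProduct_add, smul_dotProduct,
      dotProduct_smul, smul_eq_mul, e1]
    ring
  · simp only [Matrix.mulVec_sub, Matrix.mulVec_smul, sub_dotProduct, dotProduct_sub, smul_dotProduct,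
      dotProduct_smul, smul_eq_mul, e1]
    ring

/-- **Lemma C (i): numerical radius ⇒ dual-energy bound.** If `S` is symmetric positive (invertible, nonnegative
form), `T` symmetric and `|⟨A, TA⟩| ≤ r⟨A, SA⟩` for all `A` (the shape of (N′)), then `⟨TA, S⁻¹TA⟩ ≤ r²⟨A, SA⟩`:
`T` maps the energy space of `S₀ = G₀⁻¹` to its dual with norm `≤ r`. (Polarisation + parallelogram law, then the
optimal scaling.) [folklore] -/
theorem dual_energy_le (S T : Matrix n n ℝ) (hS : S.IsSymm) (hunit : IsUnit S)
    (hpos : ∀ v : n → ℝ, 0 ≤ v ⬝ᵥ (S *ᵥ v)) (hT : T.IsSymm) {r : ℝ} (hr : 0 ≤ r)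
    (hTr : ∀ A : n → ℝ, |A ⬝ᵥ (T *ᵥ A)| ≤ r * (A ⬝ᵥ (S *ᵥ A))) (A : n → ℝ) :
    (T *ᵥ A) ⬝ᵥ (S⁻¹ *ᵥ (T *ᵥ A)) ≤ r ^ 2 * (A ⬝ᵥ (S *ᵥ A)) := by
  obtain ⟨B, hB⟩ : ∃ B : n → ℝ, B = S⁻¹ *ᵥ (T *ᵥ A) := ⟨_, rfl⟩
  rw [← hB]
  have hSB : S *ᵥ B = T *ᵥ A := by rw [hB, mulVec_inv_cancel hunit]
  -- E(B) = F := ⟨TA, B⟩, q(A,B) = F, ⟨A, SB⟩ = q(A)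
  have eEB : B ⬝ᵥ (S *ᵥ B) = (T *ᵥ A) ⬝ᵥ B := by rw [hSB, dotProduct_comm]
  have eq : A ⬝ᵥ (T *ᵥ B) = (T *ᵥ A) ⬝ᵥ B := dot_mulVec_symm hT A B
  have eAS : A ⬝ᵥ (S *ᵥ B) = A ⬝ᵥ (T *ᵥ A) := by rw [hSB]
  have hF0 : 0 ≤ (T *ᵥ A) ⬝ᵥ B := by rw [← eEB]; exact hpos B
  have hE0 : 0 ≤ A ⬝ᵥ (S *ᵥ A) := hpos A
  -- key: 2 s F ≤ r (s² E + F) for all s (polarisation on s•A ± B)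
  have key : ∀ s : ℝ, 2 * s * ((T *ᵥ A) ⬝ᵥ B) ≤
      r * (s ^ 2 * (A ⬝ᵥ (S *ᵥ A)) + (T *ᵥ A) ⬝ᵥ B) := by
    intro s
    obtain ⟨ep, em⟩ := form_expand T hT s A B
    obtain ⟨sp, sm⟩ := form_expand S hS s A B
    have h1 := (abs_le.mp (hTr (s • A + B))).2
    have h2 := (abs_le.mp (hTr (s • A - B))).1
    rw [ep, sp, eq, eEB, eAS] at h1
    rw [em, sm, eq, eEB, eAS] at h2
    nlinarith [h1, h2]
  generalize hF : (T *ᵥ A) ⬝ᵥ B = F at key hF0 ⊢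
  generalize hE : A ⬝ᵥ (S *ᵥ A) = E at key hE0 ⊢
  rcases le_or_gt F 0 with hFle | hFpos
  · have hF00 : F = 0 := le_antisymm hFle hF0
    rw [hF00]
    exact mul_nonneg (pow_nonneg hr 2) hE0
  rcases eq_or_lt_of_le hr with hr0 | hrpos
  · have h1 := key 1
    rw [← hr0] at h1
    nlinarith [h1, hFpos]
  rcases eq_or_lt_of_le hE0 with hEz | hEpos
  · have h1 := key (r + 1)
    rw [← hEz] at h1
    nlinarith [h1, mul_pos hrpos hFpos]
  -- optimal scaling s = F/(rE)
  obtain ⟨s, hs⟩ : ∃ s : ℝ, s = F / (r * E) := ⟨_, rfl⟩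
  have hrE : r * E ≠ 0 := (mul_pos hrpos hEpos).ne'
  have hsrE : s * (r * E) = F := by rw [hs]; exact div_mul_cancel₀ F hrE
  have hspos : 0 < s := by rw [hs]; exact div_pos hFpos (mul_pos hrpos hEpos)
  have hk := key s
  rw [← hsrE] at hk
  have hsr : s ≤ r := by
    by_contra hcon
    have hcon' : r < s := not_le.mp hcon
    have hrsE : 0 < r * s * E := mul_pos (mul_pos hrpos hspos) hEpos
    have h5 : r * s * E * r < r * s * E * s := mul_lt_mul_of_pos_left hcon' hrsE
    nlinarith [h5, hk]
  calc F = s * (r * E) := hsrE.symm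
    _ ≤ r * (r * E) := mul_le_mul_of_nonneg_right hsr (mul_pos hrpos hEpos).le
    _ = r ^ 2 * E := by ring

/-- Energy of `Z A`, `Z = S⁻¹T`, equals the dual energy of `TA`. [folklore] -/
theorem energy_Z (S T : Matrix n n ℝ) (hunit : IsUnit S) (A : n → ℝ) :
    (S⁻¹ *ᵥ (T *ᵥ A)) ⬝ᵥ (S *ᵥ (S⁻¹ *ᵥ (T *ᵥ A))) = (T *ᵥ A) ⬝ᵥ (S⁻¹ *ᵥ (T *ᵥ A)) := by
  rw [mulVec_inv_cancel hunit, dotProduct_comm]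

/-- **Lemma C (ii): energy-norm contraction of the powers of `Z = S⁻¹T = G₀T′`:**
`⟨ZᵏA, S ZᵏA⟩ ≤ r^{2k}⟨A, SA⟩`. [folklore] -/
theorem energy_pow_le (S T : Matrix n n ℝ) (hS : S.IsSymm) (hunit : IsUnit S)
    (hpos : ∀ v : n → ℝ, 0 ≤ v ⬝ᵥ (S *ᵥ v)) (hT : T.IsSymm) {r : ℝ} (hr : 0 ≤ r)
    (hTr : ∀ A : n → ℝ, |A ⬝ᵥ (T *ᵥ A)| ≤ r * (A ⬝ᵥ (S *ᵥ A))) (k : ℕ) (A : n → ℝ) :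
    ((S⁻¹ * T) ^ k *ᵥ A) ⬝ᵥ (S *ᵥ ((S⁻¹ * T) ^ k *ᵥ A)) ≤ r ^ (2 * k) * (A ⬝ᵥ (S *ᵥ A)) := by
  induction k generalizing A with
  | zero => simp
  | succ k ih =>
    have e : (S⁻¹ * T) ^ (k + 1) *ᵥ A = (S⁻¹ * T) ^ k *ᵥ (S⁻¹ *ᵥ (T *ᵥ A)) := by
      rw [pow_succ, ← Matrix.mulVec_mulVec, ← Matrix.mulVec_mulVec]
    rw [e]
    have h1 := ih (S⁻¹ *ᵥ (T *ᵥ A))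
    have h2 : (S⁻¹ *ᵥ (T *ᵥ A)) ⬝ᵥ (S *ᵥ (S⁻¹ *ᵥ (T *ᵥ A))) ≤ r ^ 2 * (A ⬝ᵥ (S *ᵥ A)) := by
      rw [energy_Z S T hunit]
      exact dual_energy_le S T hS hunit hpos hT hr hTr A
    have h3 : 0 ≤ r ^ (2 * k) := pow_nonneg hr _
    calc ((S⁻¹ * T) ^ k *ᵥ (S⁻¹ *ᵥ (T *ᵥ A))) ⬝ᵥ (S *ᵥ ((S⁻¹ * T) ^ k *ᵥ (S⁻¹ *ᵥ (T *ᵥ A))))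
        ≤ r ^ (2 * k) * ((S⁻¹ *ᵥ (T *ᵥ A)) ⬝ᵥ (S *ᵥ (S⁻¹ *ᵥ (T *ᵥ A)))) := h1
      _ ≤ r ^ (2 * k) * (r ^ 2 * (A ⬝ᵥ (S *ᵥ A))) := mul_le_mul_of_nonneg_left h2 h3
      _ = r ^ (2 * (k + 1)) * (A ⬝ᵥ (S *ᵥ A)) := by ring

/-- `G₀(T′G₀)ᵏ = (G₀T′)ᵏG₀`: the `k`-th term of (3.130)/(3.138) in the two orders. [folklore] -/
theorem neumann_term_eq (G T : Matrix n n ℝ) (k : ℕ) : G * (T * G) ^ k = (G * T) ^ k * G := by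
  induction k with
  | zero => simp
  | succ k ih =>
    rw [pow_succ, ← mul_assoc, ih, pow_succ]
    simp only [mul_assoc]

/-- **Lemma C (iii): the `n`-th term of the Neumann series (3.130)/(3.138) in the energy norm.** Under (N′)
(`|⟨A, TA⟩| ≤ r⟨A, SA⟩`, `S = G₀⁻¹` symmetric positive, `T` symmetric):
`⟨u, G₀(TG₀)ᵏ v⟩² ≤ r^{2k} ⟨u, G₀u⟩⟨v, G₀v⟩` for all `u, v, k` — so `Σ_k G₀(TG₀)ᵏ` converges (geometrically,
ratio `r = O(1)Mα₀`) as bilinear forms on the dual energy space: this is "the norm in which (3.130) converges, the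
form (O(1)α₀)ⁿ of its n-th term" of GAPS G-B9-16. [folklore] -/
theorem neumann_term_sq_le (S T : Matrix n n ℝ) (hS : S.IsSymm) (hunit : IsUnit S)
    (hpos : ∀ v : n → ℝ, 0 ≤ v ⬝ᵥ (S *ᵥ v)) (hT : T.IsSymm) {r : ℝ} (hr : 0 ≤ r)
    (hTr : ∀ A : n → ℝ, |A ⬝ᵥ (T *ᵥ A)| ≤ r * (A ⬝ᵥ (S *ᵥ A))) (k : ℕ) (u v : n → ℝ) :
    (u ⬝ᵥ ((S⁻¹ * (T * S⁻¹) ^ k) *ᵥ v)) ^ 2 ≤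
      r ^ (2 * k) * (u ⬝ᵥ (S⁻¹ *ᵥ u)) * (v ⬝ᵥ (S⁻¹ *ᵥ v)) := by
  rw [neumann_term_eq, ← Matrix.mulVec_mulVec]
  set B := S⁻¹ *ᵥ v with hB
  set Au := S⁻¹ *ᵥ u with hAu
  set X := (S⁻¹ * T) ^ k *ᵥ B with hX
  -- ⟨u, X⟩ = ⟨Au, S X⟩
  have e1 : u ⬝ᵥ X = Au ⬝ᵥ (S *ᵥ X) := by
    rw [dot_mulVec_symm hS, hAu, mulVec_inv_cancel hunit]
  -- E(Au) = ⟨u, G₀u⟩, E(B) = ⟨v, G₀ v⟩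
  have e2 : Au ⬝ᵥ (S *ᵥ Au) = u ⬝ᵥ (S⁻¹ *ᵥ u) := by
    rw [hAu, mulVec_inv_cancel hunit, dotProduct_comm]
  have e3 : B ⬝ᵥ (S *ᵥ B) = v ⬝ᵥ (S⁻¹ *ᵥ v) := by
    rw [hB, mulVec_inv_cancel hunit, dotProduct_comm]
  have hcs := energy_cs S hS hpos Au X
  have hpow := energy_pow_le S T hS hunit hpos hT hr hTr k B
  rw [← hX] at hpow
  have h0 : 0 ≤ Au ⬝ᵥ (S *ᵥ Au) := hpos Au
  rw [e1]
  calc (Au ⬝ᵥ (S *ᵥ X)) ^ 2 ≤ (Au ⬝ᵥ (S *ᵥ Au)) * (X ⬝ᵥ (S *ᵥ X)) := hcs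
    _ ≤ (Au ⬝ᵥ (S *ᵥ Au)) * (r ^ (2 * k) * (B ⬝ᵥ (S *ᵥ B))) := mul_le_mul_of_nonneg_left hpow h0
    _ = r ^ (2 * k) * (u ⬝ᵥ (S⁻¹ *ᵥ u)) * (v ⬝ᵥ (S⁻¹ *ᵥ v)) := by rw [e2, e3]; ring

end energy

section sandwich

/-! ## 4. Forms ⇒ inverses; positivity and the form sandwich for `G`, `G₁` (Lemma D) -/

variable [DecidableEq n]

/-- **Lemma D.** For symmetric invertible `S₁`, `S₂` with nonnegative forms: `S₁ ≤ κS₂` as forms (`κ > 0`)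
implies `κ⁻¹ S₂⁻¹ ≤ S₁⁻¹` as forms (variational characterisation of `⟨x, S⁻¹x⟩`, test `κ⁻¹S₂⁻¹x`). [folklore] -/
theorem inv_form_le_of_form_le (S₁ S₂ : Matrix n n ℝ) (h1s : S₁.IsSymm) (h1u : IsUnit S₁)
    (h1p : ∀ v : n → ℝ, 0 ≤ v ⬝ᵥ (S₁ *ᵥ v)) (h2u : IsUnit S₂)
    {κ : ℝ} (hκ : 0 < κ) (h12 : ∀ x : n → ℝ, x ⬝ᵥ (S₁ *ᵥ x) ≤ κ * (x ⬝ᵥ (S₂ *ᵥ x))) (x : n → ℝ) :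
    κ⁻¹ * (x ⬝ᵥ (S₂⁻¹ *ᵥ x)) ≤ x ⬝ᵥ (S₁⁻¹ *ᵥ x) := by
  set y := S₂⁻¹ *ᵥ x with hy
  have h := two_dot_sub_form_le_inv_form S₁ h1s h1u h1p (κ⁻¹ • y) x
  simp only [dotProduct_smul, Matrix.mulVec_smul, smul_dotProduct, smul_eq_mul] at h
  have e1 : y ⬝ᵥ x = x ⬝ᵥ (S₂⁻¹ *ᵥ x) := by rw [hy, dotProduct_comm]
  have e2 : y ⬝ᵥ (S₂ *ᵥ y) = x ⬝ᵥ (S₂⁻¹ *ᵥ x) := by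
    rw [hy, mulVec_inv_cancel h2u, dotProduct_comm]
  have hP : y ⬝ᵥ (S₁ *ᵥ y) ≤ κ * (x ⬝ᵥ (S₂⁻¹ *ᵥ x)) := by rw [← e2]; exact h12 y
  rw [e1] at h
  set W := x ⬝ᵥ (S₂⁻¹ *ᵥ x) with hW
  have ht : 0 ≤ κ⁻¹ := inv_nonneg.mpr hκ.le
  have h4 : κ⁻¹ * (κ⁻¹ * (y ⬝ᵥ (S₁ *ᵥ y))) ≤ κ⁻¹ * (κ⁻¹ * (κ * W)) :=
    mul_le_mul_of_nonneg_left (mul_le_mul_of_nonneg_left hP ht) ht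
  have e3 : κ⁻¹ * (κ⁻¹ * (κ * W)) = κ⁻¹ * W := by field_simp
  rw [e3] at h4
  linarith

omit [DecidableEq n] in
/-- From (N′): `(1 − r)⟨A, SA⟩ ≤ ⟨A, (S − T)A⟩ ≤ (1 + r)⟨A, SA⟩`. [folklore] -/
theorem sub_form_bounds (S T : Matrix n n ℝ) {r : ℝ}
    (hTr : ∀ A : n → ℝ, |A ⬝ᵥ (T *ᵥ A)| ≤ r * (A ⬝ᵥ (S *ᵥ A))) (A : n → ℝ) :
    (1 - r) * (A ⬝ᵥ (S *ᵥ A)) ≤ A ⬝ᵥ ((S - T) *ᵥ A) ∧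
      A ⬝ᵥ ((S - T) *ᵥ A) ≤ (1 + r) * (A ⬝ᵥ (S *ᵥ A)) := by
  have h := abs_le.mp (hTr A)
  rw [Matrix.sub_mulVec, dotProduct_sub]
  constructor <;> nlinarith [h.1, h.2]

/-- **The Theorem 3.11 clause of Theorem 3.12 and the form sandwich, from (N′).** `S` symmetric and coercive
(`γ > 0`; plays `G₀⁻¹`, Theorem 3.11), `T` symmetric with `|⟨A, TA⟩| ≤ r⟨A, SA⟩`, `0 ≤ r < 1` (plays
`Δ′_π (+ Δ_π^{(2)})` under (N′)). Then `S − T` (= `G⁻¹`, resp. `G₁⁻¹` by (3.120)/(3.128)/(3.134)) is coercive with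
`(1 − r)γ` — in particular positive definite — and `(1 + r)⁻¹⟨x, S⁻¹x⟩ ≤ ⟨x, (S − T)⁻¹x⟩ ≤ (1 − r)⁻¹⟨x, S⁻¹x⟩`,
i.e. `(1+r)⁻¹G₀ ≤ G, G₁ ≤ (1−r)⁻¹G₀` as forms. [folklore] -/
theorem G1_sandwich (S T : Matrix n n ℝ) (hS : S.IsSymm) {γ : ℝ} (hγ : 0 < γ) (hSc : Coercive S γ)
    (hT : T.IsSymm) {r : ℝ} (hr : 0 ≤ r) (hr1 : r < 1)
    (hTr : ∀ A : n → ℝ, |A ⬝ᵥ (T *ᵥ A)| ≤ r * (A ⬝ᵥ (S *ᵥ A))) :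
    Coercive (S - T) ((1 - r) * γ) ∧
    (∀ x : n → ℝ, (1 + r)⁻¹ * (x ⬝ᵥ (S⁻¹ *ᵥ x)) ≤ x ⬝ᵥ ((S - T)⁻¹ *ᵥ x)) ∧
    (∀ x : n → ℝ, x ⬝ᵥ ((S - T)⁻¹ *ᵥ x) ≤ (1 - r)⁻¹ * (x ⬝ᵥ (S⁻¹ *ᵥ x))) := by
  have hSpos : ∀ v : n → ℝ, 0 ≤ v ⬝ᵥ (S *ᵥ v) := fun v =>
    (mul_nonneg hγ.le (Literature.LinearAlgebra.Matrix.dotProduct_self_nonneg_real v)).trans (hSc v)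
  have hSu : IsUnit S := isUnit_of_coercive hγ hSc
  have h1r : 0 < 1 - r := by linarith
  have hc : Coercive (S - T) ((1 - r) * γ) := by
    intro x
    have hb := (sub_form_bounds S T hTr x).1
    have hx := hSc x
    have h0 : 0 ≤ x ⬝ᵥ x := Literature.LinearAlgebra.Matrix.dotProduct_self_nonneg_real x
    calc (1 - r) * γ * (x ⬝ᵥ x) = (1 - r) * (γ * (x ⬝ᵥ x)) := by ring
      _ ≤ (1 - r) * (x ⬝ᵥ (S *ᵥ x)) := mul_le_mul_of_nonneg_left hx h1r.le
      _ ≤ x ⬝ᵥ ((S - T) *ᵥ x) := hb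
  have hγ' : 0 < (1 - r) * γ := mul_pos h1r hγ
  have h1sym : (S - T).IsSymm := hS.sub hT
  have h1u : IsUnit (S - T) := isUnit_of_coercive hγ' hc
  have h1pos : ∀ v : n → ℝ, 0 ≤ v ⬝ᵥ ((S - T) *ᵥ v) := fun v =>
    (mul_nonneg hγ'.le (Literature.LinearAlgebra.Matrix.dotProduct_self_nonneg_real v)).trans (hc v)
  refine ⟨hc, ?_, ?_⟩
  · -- (S − T) ≤ (1 + r) S  ⇒  (1+r)⁻¹ S⁻¹ ≤ (S−T)⁻¹
    intro x
    have hr' : 0 < 1 + r := by linarith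
    exact inv_form_le_of_form_le (S - T) S h1sym h1u h1pos hSu hr'
      (fun A => (sub_form_bounds S T hTr A).2) x
  · -- S ≤ (1−r)⁻¹ (S − T)  ⇒  (1−r) (S−T)⁻¹ ≤ S⁻¹
    intro x
    have hκ : 0 < (1 - r)⁻¹ := inv_pos.mpr h1r
    have h12 : ∀ A : n → ℝ, A ⬝ᵥ (S *ᵥ A) ≤ (1 - r)⁻¹ * (A ⬝ᵥ ((S - T) *ᵥ A)) := by
      intro A
      have hb := (sub_form_bounds S T hTr A).1
      rw [le_inv_mul_iff₀ h1r]
      exact hb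
    have h := inv_form_le_of_form_le S (S - T) hS hSu hSpos h1u hκ h12 x
    rw [inv_inv] at h
    rw [le_inv_mul_iff₀ h1r]
    exact h

end sandwich

section assembly

/-! ## 5. The AM–GM assembly of §5 of the md -/

/-- **Assembly.** If the weighted mass and the divergence are controlled by the energy,
`nw² ≤ c₀E`, `nd² ≤ C⋆E`, and a quadratic form obeys the absolute bound `|q| ≤ κ₁·nw·nd + κ₂·nd²`
(`κ₁, κ₂ ≥ 0`), then `|q| ≤ (κ₁(c₀ + C⋆)/2 + κ₂C⋆)·E` — the passage from the Cauchy–Schwarz bound on the three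
terms of (3.120) to the relative bound `|⟨A, Δ′_πA⟩| ≤ r′⟨A, G₀⁻¹A⟩`. [folklore] -/
theorem rel_bound_of_abs_bound {q E nw nd κ₁ κ₂ c₀ Cs : ℝ} (hκ₁ : 0 ≤ κ₁) (hκ₂ : 0 ≤ κ₂)
    (hw : nw ^ 2 ≤ c₀ * E) (hd : nd ^ 2 ≤ Cs * E)
    (habs : |q| ≤ κ₁ * (nw * nd) + κ₂ * nd ^ 2) :
    |q| ≤ (κ₁ * ((c₀ + Cs) / 2) + κ₂ * Cs) * E := by
  have h1 : nw * nd ≤ (nw ^ 2 + nd ^ 2) / 2 := by nlinarith [sq_nonneg (nw - nd)]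
  have h2 : nw * nd ≤ (c₀ * E + Cs * E) / 2 := by linarith
  have h3 : κ₁ * (nw * nd) ≤ κ₁ * ((c₀ * E + Cs * E) / 2) := mul_le_mul_of_nonneg_left h2 hκ₁
  have h4 : κ₂ * nd ^ 2 ≤ κ₂ * (Cs * E) := mul_le_mul_of_nonneg_left hd hκ₂
  calc |q| ≤ κ₁ * (nw * nd) + κ₂ * nd ^ 2 := habs
    _ ≤ κ₁ * ((c₀ * E + Cs * E) / 2) + κ₂ * (Cs * E) := add_le_add h3 h4
    _ = (κ₁ * ((c₀ + Cs) / 2) + κ₂ * Cs) * E := by ring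

end assembly

section nonvacuous

/-! ## 6. The hypotheses are satisfiable (a `1 × 1` instance) -/

/-- The hypothesis set of `G1_sandwich` / `neumann_term_sq_le` is non-vacuous: `S = 1`, `T = ½·1`, `γ = 1`,
`r = ½` on `Fin 1`. -/
example : ∃ (S T : Matrix (Fin 1) (Fin 1) ℝ) (γ r : ℝ), S.IsSymm ∧ 0 < γ ∧ Coercive S γ ∧ T.IsSymm ∧
    0 ≤ r ∧ r < 1 ∧ ∀ A : Fin 1 → ℝ, |A ⬝ᵥ (T *ᵥ A)| ≤ r * (A ⬝ᵥ (S *ᵥ A)) := by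
  refine ⟨1, (1/2 : ℝ) • (1 : Matrix (Fin 1) (Fin 1) ℝ), 1, 1/2, Matrix.isSymm_one, one_pos, ?_,
    (Matrix.isSymm_one).smul _, by norm_num, by norm_num, ?_⟩
  · intro x
    simp [Matrix.one_mulVec]
  · intro A
    have h0 : 0 ≤ A ⬝ᵥ A := Literature.LinearAlgebra.Matrix.dotProduct_self_nonneg_real A
    simp only [Matrix.smul_mulVec, Matrix.one_mulVec, dotProduct_smul, smul_eq_mul]
    exact le_of_eq (abs_of_nonneg (mul_nonneg (by norm_num) h0))

end nonvacuous

end Literature.MathematicalPhysics.QuantumFieldTheory.Balaban1983to89.B9SectDForm
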